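import Literature.InformationTheory.QuantumCodes.ToricCodeMatching
import HarnessLib

/-!
# The taxicab (Manhattan) distance on the torus is an admissible MWPM link metric, with geodesics

Topic `Literature/InformationTheory/QuantumCodes` (venture QEC, LADDER-QEC Q5 «toric/surface + MWPM»; qec-type-09 gen 4).
Companion of `ToricCodeMatching.lean`. There the MWPM theorems are stated for EVERY link metric
(`EdgeMetric`: symmetric, triangle inequality, `≤ 1` across links) with the canonical instance = shortest-chain
distance `chainMetric`. Implementations of matching decoders for the toric code weight a pair of defects by the
MANHATTAN DISTANCE ON THE TORUS, `dist(u, v) = Σᵢ min(|uᵢ - vᵢ|, L - |uᵢ - vᵢ|)` (Dennis–Kitaev–Landahl–Preskill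
§4.4 p. 18: weights = chain lengths, "the minimum weight chain with a specified boundary … perfect matching
algorithm of Edmonds"). This file PROVES (0 facts): the cyclic norm `cnorm` on `ℤ_L` and the torus taxicab
distance `torusDist` are symmetric, satisfy the triangle inequality and are `≤ 1` across every lattice link
(`taxicabMetric : EdgeMetric (starEnds L)`, `taxicabMetricPlaq : EdgeMetric (plaqEnds L)`); every two sites are
joined by a chain of exactly... at most `torusDist` links (`exists_geodesic`, by cyclic descent), so that the
shortest-chain distance IS the taxicab distance (`chainDist_starEnds_eq_torusDist`) and taxicab-MWPM decoders
exist (`exists_isMatchingDecoder_taxicab`) — hence are minimum-weight decoders by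
`isMinWeight_of_isMatchingDecoder_star`.

## References
* [DennisEtAl2002] E. Dennis, A. Kitaev, A. Landahl, J. Preskill, *Topological quantum memory*, J. Math.
  Phys. 43 (2002) 4452–4505, arXiv:quant-ph/0110143, §3.1 (L × L torus), §4.4 p. 18.
* [KorteVygen2002] B. Korte, J. Vygen, *Combinatorial Optimization*, 2nd ed., Springer (2002), §12.2 proof of
  Thm 12.9 (metric closure).
-/

namespace Literature.InformationTheory.QuantumCodes

open Finset Matrix Literature.Barriers.PneNP
open Literature.Probability.LatticeModels (TorusSite)

namespace ToricCode

variable {L : ℕ}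

/-! ### The cyclic norm on `ℤ_L` -/

/-- The cyclic norm on `ℤ_L`: the graph distance from `0` on the `L`-cycle, `min(x, L - x)` for the
representative `0 ≤ x < L`. (definition) [cite: DennisEtAl2002, §3.1 (periodic L × L lattice)] -/
def cnorm (x : ZMod L) : ℕ :=
  min x.val (L - x.val)

/-- `cnorm 0 = 0`. [cite: DennisEtAl2002, §3.1] -/
@[simp] theorem cnorm_zero [NeZero L] : cnorm (0 : ZMod L) = 0 := by
  simp [cnorm, ZMod.val_zero]

/-- `cnorm x = 0 ↔ x = 0`. [cite: DennisEtAl2002, §3.1] -/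
theorem cnorm_eq_zero_iff [NeZero L] {x : ZMod L} : cnorm x = 0 ↔ x = 0 := by
  constructor
  · intro h
    have hlt := ZMod.val_lt x
    have : x.val = 0 := by unfold cnorm at h; omega
    exact (ZMod.val_eq_zero x).1 this
  · rintro rfl
    exact cnorm_zero

/-- The cyclic norm is symmetric: `cnorm (-x) = cnorm x`. [cite: DennisEtAl2002, §3.1] -/
theorem cnorm_neg [NeZero L] (x : ZMod L) : cnorm (-x) = cnorm x := by
  unfold cnorm
  rw [ZMod.neg_val]
  have hlt := ZMod.val_lt x
  split_ifs with h
  · subst h; simp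
  · have : x.val ≠ 0 := fun h' => h ((ZMod.val_eq_zero x).1 h')
    omega

/-- Triangle inequality for the cyclic norm. [cite: DennisEtAl2002, §3.1] -/
theorem cnorm_add_le [NeZero L] (x y : ZMod L) : cnorm (x + y) ≤ cnorm x + cnorm y := by
  unfold cnorm
  rw [ZMod.val_add]
  have hx := ZMod.val_lt x
  have hy := ZMod.val_lt y
  by_cases h : x.val + y.val < L
  · rw [Nat.mod_eq_of_lt h]
    omega
  · rw [Nat.mod_eq_sub_mod (by omega), Nat.mod_eq_of_lt (by omega)]
    omega

/-- A single step has cyclic norm at most one: `cnorm 1 ≤ 1`. [cite: DennisEtAl2002, §3.1] -/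
theorem cnorm_one_le [NeZero L] : cnorm (1 : ZMod L) ≤ 1 := by
  unfold cnorm
  rw [ZMod.val_one_eq_one_mod]
  exact (min_le_left _ _).trans (Nat.mod_le 1 L)

/-- **Cyclic descent**: from every `x ≠ 0` one of the two neighbours `x ± 1` is strictly closer to `0`.
[cite: DennisEtAl2002, §3.1 (periodic lattice)] -/
theorem cnorm_descent [NeZero L] {x : ZMod L} (hx : x ≠ 0) :
    cnorm (x - 1) + 1 = cnorm x ∨ cnorm (x + 1) + 1 = cnorm x := by
  have hlt := ZMod.val_lt x
  have hx0 : x.val ≠ 0 := fun h => hx ((ZMod.val_eq_zero x).1 h)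
  have hL : 1 < L := by omega
  haveI : Fact (1 < L) := ⟨hL⟩
  have h1 : (1 : ZMod L).val = 1 := ZMod.val_one L
  by_cases hc : 2 * x.val ≤ L
  · left
    unfold cnorm
    rw [ZMod.val_sub (by rw [h1]; omega), h1]
    omega
  · right
    unfold cnorm
    rw [ZMod.val_add, h1]
    by_cases h2 : x.val + 1 < L
    · rw [Nat.mod_eq_of_lt h2]
      omega
    · have h3 : x.val + 1 = L := by omega
      rw [h3, Nat.mod_self]
      omega

/-! ### The taxicab distance on the torus -/

/-- The **taxicab (Manhattan) distance on the `L × L` torus**: the sum of the cyclic norms of the coordinate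
differences — the length of a shortest lattice path. (definition) [cite: DennisEtAl2002, §4.4 p. 18 (minimum weight chain = fewest links)] -/
def torusDist (u v : Vertex L) : ℕ :=
  cnorm (u 0 - v 0) + cnorm (u 1 - v 1)

/-- `torusDist u u = 0`. [cite: DennisEtAl2002, §3.1] -/
@[simp] theorem torusDist_self [NeZero L] (u : Vertex L) : torusDist u u = 0 := by
  simp [torusDist]

/-- Symmetry. [cite: DennisEtAl2002, §3.1] -/
theorem torusDist_comm [NeZero L] (u v : Vertex L) : torusDist u v = torusDist v u := by
  unfold torusDist
  rw [← cnorm_neg (u 0 - v 0), ← cnorm_neg (u 1 - v 1), neg_sub, neg_sub]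

/-- Triangle inequality. [cite: DennisEtAl2002, §3.1] -/
theorem torusDist_triangle [NeZero L] (u v w : Vertex L) : torusDist u w ≤ torusDist u v + torusDist v w := by
  unfold torusDist
  have h0 := cnorm_add_le (u 0 - v 0) (v 0 - w 0)
  have h1 := cnorm_add_le (u 1 - v 1) (v 1 - w 1)
  rw [sub_add_sub_cancel] at h0 h1
  omega

/-- A lattice link has taxicab length at most one: `dist(v, v + eᵢ) ≤ 1`. [cite: DennisEtAl2002, §3.1] -/
theorem torusDist_add_dir_le [NeZero L] (v : Vertex L) (i : Fin 2) : torusDist v (v + dir i) ≤ 1 := by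
  unfold torusDist
  have h := cnorm_one_le (L := L)
  have hn : cnorm (-1 : ZMod L) ≤ 1 := by rw [cnorm_neg]; exact h
  fin_cases i <;> simp [dir, hn]

/-- `dist(u, v) = 0 ↔ u = v`. [cite: DennisEtAl2002, §3.1] -/
theorem torusDist_eq_zero_iff [NeZero L] {u v : Vertex L} : torusDist u v = 0 ↔ u = v := by
  constructor
  · intro h
    unfold torusDist at h
    have h0 : cnorm (u 0 - v 0) = 0 := by omega
    have h1 : cnorm (u 1 - v 1) = 0 := by omega
    rw [cnorm_eq_zero_iff, sub_eq_zero] at h0 h1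
    funext j
    fin_cases j
    · exact h0
    · exact h1
  · rintro rfl
    exact torusDist_self u

variable (L) in
/-- **The taxicab metric is an admissible MWPM link metric for the star syndrome** (site defects).
[cite: DennisEtAl2002, §4.4 p. 18] -/
def taxicabMetric [NeZero L] : EdgeMetric (starEnds L) where
  d := torusDist
  symm := torusDist_comm
  triangle := torusDist_triangle
  ends_le_one := by
    rintro ⟨v, i⟩ a b h
    simp only [starEnds, Sym2.eq_iff] at h
    rcases h with ⟨rfl, rfl⟩ | ⟨rfl, rfl⟩
    · exact torusDist_add_dir_le _ _
    · rw [torusDist_comm]; exact torusDist_add_dir_le _ _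

variable (L) in
/-- … and for the plaquette syndrome (plaquette defects, dual lattice; the same distance on lower-left corners).
[cite: DennisEtAl2002, §4.1 (dual lattice) and §4.4 p. 18] -/
def taxicabMetricPlaq [NeZero L] : EdgeMetric (plaqEnds L) where
  d := torusDist
  symm := torusDist_comm
  triangle := torusDist_triangle
  ends_le_one := by
    rintro ⟨v, i⟩ a b h
    simp only [plaqEnds, Sym2.eq_iff] at h
    have key : torusDist v (v - dir (Fin.rev i)) ≤ 1 := by
      have := torusDist_add_dir_le (v - dir (Fin.rev i)) (Fin.rev i)
      rwa [sub_add_cancel, torusDist_comm] at this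
    rcases h with ⟨rfl, rfl⟩ | ⟨rfl, rfl⟩
    · exact key
    · rw [torusDist_comm]; exact key

/-! ### Geodesics: chains of at most `dist` links, and `chainDist = torusDist` -/

/-- **Geodesics exist**: every two sites `a, b` are joined by a chain (set of links) with boundary `{a, b}`
and at most `dist(a, b)` links (walk the shorter way round in each coordinate).
[cite: DennisEtAl2002, §4.4 p. 18 (minimum weight chain with a specified boundary)] -/
theorem exists_geodesic [NeZero L] (a b : Vertex L) :
    ∃ γ : Chain L, graphSyn (starEnds L) γ = pairIndicator s(a, b) ∧ hammingNorm γ ≤ torusDist a b := by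
  suffices h : ∀ (n : ℕ) (a : Vertex L), torusDist a b = n →
      ∃ γ : Chain L, graphSyn (starEnds L) γ = pairIndicator s(a, b) ∧ hammingNorm γ ≤ n from
    h _ a rfl
  intro n
  induction n with
  | zero =>
    intro a ha
    rw [torusDist_eq_zero_iff] at ha
    subst ha
    exact ⟨0, by rw [graphSyn_zero, pairIndicator_diag], by simp⟩
  | succ k ih =>
    intro a ha
    -- some coordinate difference is non-zero; step so that it decreases
    have hstep : ∃ a' : Vertex L, (∃ ℓ : Edge L, starEnds L ℓ = s(a, a')) ∧ torusDist a' b = k := by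
      by_cases h0 : a 0 - b 0 = 0
      · -- move in coordinate 1
        have h1 : a 1 - b 1 ≠ 0 := by
          intro h1
          have : torusDist a b = 0 := by simp [torusDist, h0, h1]
          omega
        rcases cnorm_descent h1 with h | h
        · refine ⟨a - dir 1, ⟨(a - dir 1, 1), ?_⟩, ?_⟩
          · simp only [starEnds, sub_add_cancel]; exact Sym2.eq_swap
          · unfold torusDist at ha ⊢
            have e0 : (a - dir 1 : Vertex L) 0 - b 0 = a 0 - b 0 := by simp [dir]
            have e1 : (a - dir 1 : Vertex L) 1 - b 1 = a 1 - b 1 - 1 := by simp [dir]; ring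
            rw [e0, e1]; omega
        · refine ⟨a + dir 1, ⟨(a, 1), rfl⟩, ?_⟩
          unfold torusDist at ha ⊢
          have e0 : (a + dir 1 : Vertex L) 0 - b 0 = a 0 - b 0 := by simp [dir]
          have e1 : (a + dir 1 : Vertex L) 1 - b 1 = a 1 - b 1 + 1 := by simp [dir]; ring
          rw [e0, e1]; omega
      · rcases cnorm_descent h0 with h | h
        · refine ⟨a - dir 0, ⟨(a - dir 0, 0), ?_⟩, ?_⟩
          · simp only [starEnds, sub_add_cancel]; exact Sym2.eq_swap
          · unfold torusDist at ha ⊢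
            have e0 : (a - dir 0 : Vertex L) 0 - b 0 = a 0 - b 0 - 1 := by simp [dir]; ring
            have e1 : (a - dir 0 : Vertex L) 1 - b 1 = a 1 - b 1 := by simp [dir]
            rw [e0, e1]; omega
        · refine ⟨a + dir 0, ⟨(a, 0), rfl⟩, ?_⟩
          unfold torusDist at ha ⊢
          have e0 : (a + dir 0 : Vertex L) 0 - b 0 = a 0 - b 0 + 1 := by simp [dir]; ring
          have e1 : (a + dir 0 : Vertex L) 1 - b 1 = a 1 - b 1 := by simp [dir]
          rw [e0, e1]; omega
    obtain ⟨a', ⟨ℓ, hℓ⟩, hk⟩ := hstep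
    obtain ⟨γ, hγ, hn⟩ := ih a' hk
    refine ⟨Pi.single ℓ 1 + γ, ?_, ?_⟩
    · rw [graphSyn_add, graphSyn_single, hℓ, hγ, pairIndicator_add_pairIndicator]
    · refine (hammingNorm_add_le_add _ _).trans ?_
      have h1 : hammingNorm (Pi.single ℓ (1 : ZMod 2) : Chain L) ≤ 1 := by
        change (supp (Pi.single ℓ (1 : ZMod 2) : Chain L)).card ≤ 1
        refine card_le_one.2 fun i hi j hj => ?_
        rw [mem_supp_iff] at hi hj
        by_contra hij
        rcases eq_or_ne i ℓ with rfl | hi'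
        · exact hj (Pi.single_eq_of_ne (Ne.symm hij) _)
        · exact hi (Pi.single_eq_of_ne hi' _)
      omega

/-- **The shortest-chain distance of the toric lattice IS the taxicab distance**: `chainDist (starEnds L) a b =
dist(a, b)` (so the canonical `starMetric` and `taxicabMetric` agree). [cite: DennisEtAl2002, §4.4 p. 18] -/
theorem chainDist_starEnds_eq_torusDist [NeZero L] (a b : Vertex L) : chainDist (starEnds L) a b = torusDist a b := by
  refine le_antisymm ?_ ?_
  · obtain ⟨γ, hγ, hn⟩ := exists_geodesic a b
    exact (chainDist_le_hammingNorm hγ).trans hn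
  · by_cases hab : a = b
    · subst hab; simp
    · exact (taxicabMetric L).d_le_chainDist (star_isLinkConnected L) hab

variable (L) in
/-- **Non-vacuity**: a taxicab-MWPM decoder of the star syndrome exists (hence, by
`isMinWeight_of_isMatchingDecoder_star`, a minimum-weight decoder obtained by Manhattan-weight matching).
[cite: DennisEtAl2002, §4.4 p. 18] -/
theorem exists_isMatchingDecoder_taxicab [NeZero L] : ∃ D : ZDecoder L, IsMatchingDecoder (taxicabMetric L) D :=
  exists_isMatchingDecoder_of_geodesics _ exists_geodesic

end ToricCode

end Literature.InformationTheory.QuantumCodes
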